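import Summits.AtomisticToContinuum.FouriersLaw.Theorems.BondHeatUncertaintySubdiffusiveBondHeatGibbsMomentumFourthMoment

/-!
# Static covariance of the bath-site energy with its flux under the Gibbs state

Helper (`--supports`) for the line `bath-bond-deficit-integral` of the crux
`BondHeatUncertainty.SubdiffusiveBondHeat` (stmt-AtomisticToContinuum-9120): the registered stub
`stub_siteEnergyCurrentCovariance` (fact (H4) of the conditional bath-bond reduction).

For the pinned anharmonic chain `pinnedChain ω₂ lam β γ` with `N ≥ 2` sites and its Gibbs measure
`μ_T = Z⁻¹ e^{-H/T} dq dp` (`OscillatorChain.gibbsMeasure`), with the bath-site energy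
`e₀ = p₀²/2 + U(q₀) + V(q₁ - q₀)/2` and the bond current `j₀ = -½ (p₀ + p₁) V'(q₁ - q₀)`
(`OscillatorChain.bondCurrent N 0`):
`∫ e₀ (j₀ - γ (T - p₀²)) dμ_T ≤ γ T²` — in fact with equality:
* `∫ e₀ j₀ e^{-H/T} = 0` by momentum reversal (`e₀` is even, `j₀` odd, `e^{-H/T} dq dp` invariant:
  `integral_comp_momentumReversal`, `OscillatorChain.bondCurrent_neg_momentum`);
* for the position part `G(q) = U(q₀) + V(q₁ - q₀)/2`: `∫ G p₀² e^{-H/T} = T ∫ G e^{-H/T}`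
  (Gaussian integration by parts in `p₀`, `p₀ e^{-H/T} = -T ∂_{p₀} e^{-H/T}`,
  `integral_mul_eq_neg_of_hasLineDerivAt_of_integrable`);
* `∫ p₀² e^{-H/T} = T Z`, `∫ p₀⁴ e^{-H/T} = 3 T² Z` (`pinnedChain_integral_momentum_pow_add_two`),
whence `∫ e₀ (j₀ - γ(T - p₀²)) e^{-H/T} = γ (½ · 3T² - ½ T · T) Z = γ T² Z`.
Integrability of `e₀ j₀ e^{-H/T}` (cubic in `1 + H`) comes from `(1 + H)⁴ e^{-H/T} ∈ L¹`
(`(ϑ(1+H))⁴/4! ≤ e^{ϑ(1+H)}`, `ϑ = 1/(2T)`, `pinnedChain_integrable_exp_mul_gibbsDensity`).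
-/

noncomputable section

open MeasureTheory

namespace Summit.AtomisticToContinuum.FouriersLaw.Theorems.SubdiffusiveBondHeat

open Literature.MathematicalPhysics.KineticTheory.HeatConduction

/-- Bookkeeping for the covariance computation: if `e = p₂/2 + G`, `p₄ = p₂²`,
`∫ e·j·ρ = 0`, `∫ p₂ ρ = T ∫ ρ`, `∫ p₄ ρ = 3T ∫ p₂ ρ` and `∫ G p₂ ρ = T ∫ G ρ` (all integrands
integrable), then `∫ e (j - c (T - p₂)) ρ = c T² ∫ ρ`. [folklore] -/
theorem integral_siteEnergy_combination {α : Type*} [MeasurableSpace α] {μ : Measure α}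
    {e jb ρ p2 p4 G : α → ℝ} {c T : ℝ}
    (f1i : Integrable (fun x => e x * jb x * ρ x) μ) (f1z : ∫ x, e x * jb x * ρ x ∂μ = 0)
    (f2i : Integrable (fun x => p2 x * ρ x) μ) (m2 : ∫ x, p2 x * ρ x ∂μ = T * ∫ x, ρ x ∂μ)
    (f3i : Integrable (fun x => p4 x * ρ x) μ)
    (m4 : ∫ x, p4 x * ρ x ∂μ = T * (2 + 1) * ∫ x, p2 x * ρ x ∂μ)
    (f4i : Integrable (fun x => G x * ρ x) μ) (f5i : Integrable (fun x => G x * p2 x * ρ x) μ)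
    (hIBP : ∫ x, G x * p2 x * ρ x ∂μ = T * ∫ x, G x * ρ x ∂μ)
    (he : ∀ x, e x = p2 x / 2 + G x) (hp4 : ∀ x, p4 x = p2 x * p2 x) :
    ∫ x, e x * (jb x - c * (T - p2 x)) * ρ x ∂μ = c * T ^ 2 * ∫ x, ρ x ∂μ := by
  have key : ∀ x, e x * (jb x - c * (T - p2 x)) * ρ x =
      e x * jb x * ρ x - c * T / 2 * (p2 x * ρ x) - c * T * (G x * ρ x) +
        c / 2 * (p4 x * ρ x) + c * (G x * p2 x * ρ x) := by
    intro x
    linear_combination (c * p2 x * ρ x - c * T * ρ x) * he x - (c / 2 * ρ x) * hp4 x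
  rw [integral_congr_ae (Filter.Eventually.of_forall key)]
  have hA : Integrable (fun x => e x * jb x * ρ x - c * T / 2 * (p2 x * ρ x)) μ :=
    f1i.sub (f2i.const_mul _)
  have hB : Integrable (fun x => e x * jb x * ρ x - c * T / 2 * (p2 x * ρ x) -
      c * T * (G x * ρ x)) μ := hA.sub (f4i.const_mul _)
  have hC : Integrable (fun x => e x * jb x * ρ x - c * T / 2 * (p2 x * ρ x) -
      c * T * (G x * ρ x) + c / 2 * (p4 x * ρ x)) μ := hB.add (f3i.const_mul _)
  rw [integral_add hC (f5i.const_mul _), integral_add hB (f3i.const_mul _),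
    integral_sub hA (f4i.const_mul _), integral_sub f1i (f2i.const_mul _), f1z,
    integral_const_mul, integral_const_mul, integral_const_mul, integral_const_mul, hIBP, m4, m2]
  ring

section Pinned

variable {ω₂ lam β : ℝ}

/-- `(1 + H)⁴ e^{-H/T}` is Lebesgue integrable for the pinned chain (`ω₂ > 0`, `lam, β ≥ 0`,
`T > 0`): `(ϑ (1 + H))⁴ / 4! ≤ e^{ϑ (1 + H)}` with `ϑ = 1/(2T)` and `e^{ϑ H} e^{-H/T} ∈ L¹`.
[folklore] -/
theorem pinnedChain_integrable_one_add_pow_four_mul_gibbsDensity (hω : 0 < ω₂) (hl : 0 ≤ lam)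
    (hβ : 0 ≤ β) (γ : ℝ) (N : ℕ) {T : ℝ} (hT : 0 < T) :
    Integrable fun x => (1 + (pinnedChain ω₂ lam β γ).hamiltonian N x) ^ 4 *
      (pinnedChain ω₂ lam β γ).gibbsDensity N T x := by
  have hT' : 0 < T⁻¹ := inv_pos.mpr hT
  have hϑ0 : 0 < T⁻¹ / 2 := by positivity
  have hϑ1 : T⁻¹ / 2 < 1 / T := by rw [one_div]; linarith
  have hexp := pinnedChain_integrable_exp_mul_gibbsDensity hω hl hβ γ N hT hϑ1
  refine (hexp.const_mul (24 * Real.exp (T⁻¹ / 2) / (T⁻¹ / 2) ^ 4)).mono' ?_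
    (Filter.Eventually.of_forall fun x => ?_)
  · exact (((continuous_const.add (pinnedChain_continuous_hamiltonian ω₂ lam β γ N)).pow 4).mul
      (pinnedChain_continuous_gibbsDensity ω₂ lam β γ N T)).aestronglyMeasurable
  have hH0 := pinnedChain_hamiltonian_nonneg hω.le hl hβ γ N x
  have hρ : 0 < (pinnedChain ω₂ lam β γ).gibbsDensity N T x :=
    (pinnedChain ω₂ lam β γ).gibbsDensity_pos N T x
  set H := (pinnedChain ω₂ lam β γ).hamiltonian N x with hHdef
  set ϑ := T⁻¹ / 2 with hϑ
  have hx : 0 ≤ ϑ * (1 + H) := by positivity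
  have key := Real.pow_div_factorial_le_exp _ hx 4
  have h24 : ((4 : ℕ).factorial : ℝ) = 24 := by norm_num [Nat.factorial]
  rw [h24, div_le_iff₀ (by norm_num : (0 : ℝ) < 24)] at key
  have hsplit : Real.exp (ϑ * (1 + H)) = Real.exp ϑ * Real.exp (ϑ * H) := by
    rw [← Real.exp_add]; ring_nf
  have hϑ4 : 0 < ϑ ^ 4 := by positivity
  have h1 : (1 + H) ^ 4 ≤ 24 * Real.exp ϑ / ϑ ^ 4 * Real.exp (ϑ * H) := by
    rw [div_mul_eq_mul_div, le_div_iff₀ hϑ4]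
    calc (1 + H) ^ 4 * ϑ ^ 4 = (ϑ * (1 + H)) ^ 4 := by ring
      _ ≤ Real.exp (ϑ * (1 + H)) * 24 := key
      _ = 24 * Real.exp ϑ * Real.exp (ϑ * H) := by rw [hsplit]; ring
  rw [Real.norm_eq_abs, abs_mul, abs_of_nonneg (by positivity), abs_of_pos hρ]
  calc (1 + H) ^ 4 * (pinnedChain ω₂ lam β γ).gibbsDensity N T x
      ≤ 24 * Real.exp ϑ / ϑ ^ 4 * Real.exp (ϑ * H) *
          (pinnedChain ω₂ lam β γ).gibbsDensity N T x := mul_le_mul_of_nonneg_right h1 hρ.le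
    _ = _ := by rw [mul_assoc]

/-- A continuous observable dominated by `C (1 + H)⁴` is integrable against `e^{-H/T}`
(pinned chain, `T > 0`). [folklore] -/
theorem pinnedChain_integrable_mul_gibbsDensity_of_le_pow_four (hω : 0 < ω₂) (hl : 0 ≤ lam)
    (hβ : 0 ≤ β) (γ : ℝ) (N : ℕ) {T : ℝ} (hT : 0 < T) {g : PhaseSpace N → ℝ} (hg : Continuous g)
    {C : ℝ} (hle : ∀ x, |g x| ≤ C * (1 + (pinnedChain ω₂ lam β γ).hamiltonian N x) ^ 4) :
    Integrable fun x => g x * (pinnedChain ω₂ lam β γ).gibbsDensity N T x := by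
  have hmaj := (pinnedChain_integrable_one_add_pow_four_mul_gibbsDensity hω hl hβ γ N hT).const_mul C
  refine hmaj.mono'
    ((hg.mul (pinnedChain_continuous_gibbsDensity ω₂ lam β γ N T)).aestronglyMeasurable)
    (Filter.Eventually.of_forall fun x => ?_)
  have hρ : 0 < (pinnedChain ω₂ lam β γ).gibbsDensity N T x :=
    (pinnedChain ω₂ lam β γ).gibbsDensity_pos N T x
  rw [Real.norm_eq_abs, abs_mul, abs_of_pos hρ, ← mul_assoc]
  exact mul_le_mul_of_nonneg_right (hle x) hρ.le

/-- `p_i² ≤ 2H` for the pinned chain (`lam, β ≥ 0`). [folklore] -/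
theorem pinnedChain_sq_momentum_le (hω : 0 ≤ ω₂) (hl : 0 ≤ lam) (hβ : 0 ≤ β) (γ : ℝ) (N : ℕ)
    (x : PhaseSpace N) (i : Fin N) :
    x.2 i ^ 2 ≤ 2 * (pinnedChain ω₂ lam β γ).hamiltonian N x := by
  have h := pinnedChain_harmonic_le_hamiltonian (ω₂ := ω₂) hl hβ γ N x
  have h1 : x.2 i ^ 2 / 2 ≤ ∑ k, x.2 k ^ 2 / 2 :=
    Finset.single_le_sum (f := fun k => x.2 k ^ 2 / 2) (fun k _ => by positivity)
      (Finset.mem_univ i)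
  have h2 : 0 ≤ ∑ k, ω₂ * x.1 k ^ 2 / 2 := Finset.sum_nonneg fun k _ => by positivity
  linarith

/-- **Parity.** For an observable `E` even under momentum reversal, `∫ E j_i e^{-H/T} dq dp = 0`
(the bond current is odd, `H` is even, Lebesgue measure is reversal invariant; no integrability
needed: both sides are Bochner integrals of a function and its negative). [folklore] -/
theorem pinnedChain_integral_even_mul_bondCurrent_mul_gibbsDensity (ω₂ lam β γ : ℝ) (N : ℕ)
    (T : ℝ) (i : Fin N) {E : PhaseSpace N → ℝ} (hE : ∀ x : PhaseSpace N, E (x.1, -x.2) = E x) :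
    ∫ x, E x * (pinnedChain ω₂ lam β γ).bondCurrent N i x *
        (pinnedChain ω₂ lam β γ).gibbsDensity N T x = 0 := by
  have h := integral_comp_momentumReversal N fun x =>
    E x * (pinnedChain ω₂ lam β γ).bondCurrent N i x * (pinnedChain ω₂ lam β γ).gibbsDensity N T x
  simp only [hE, OscillatorChain.bondCurrent_neg_momentum, OscillatorChain.gibbsDensity,
    OscillatorChain.hamiltonian_neg_momentum, mul_neg, neg_mul, integral_neg] at h
  simp only [OscillatorChain.gibbsDensity]
  linarith

/-- **Gaussian integration by parts in one momentum against a position observable.** For a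
continuous `G = G(q)` with `|G| ≤ C (1 + H)`: `G e^{-H/T}` and `G p_i² e^{-H/T}` are integrable and
`∫ G p_i² e^{-H/T} = T ∫ G e^{-H/T}` (`p_i e^{-H/T} = -T ∂_{p_i} e^{-H/T}`, `∂_{p_i} G = 0`).
[folklore] -/
theorem pinnedChain_integral_posObs_sq_momentum_mul_gibbsDensity (hω : 0 < ω₂) (hl : 0 ≤ lam)
    (hβ : 0 ≤ β) (γ : ℝ) (N : ℕ) {T : ℝ} (hT : 0 < T) (i : Fin N) {G : (Fin N → ℝ) → ℝ}
    (hG : Continuous G) {C : ℝ} (hC : 0 ≤ C)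
    (hle : ∀ x : PhaseSpace N, |G x.1| ≤ C * (1 + (pinnedChain ω₂ lam β γ).hamiltonian N x)) :
    (Integrable fun x => G x.1 * (pinnedChain ω₂ lam β γ).gibbsDensity N T x) ∧
    (Integrable fun x => G x.1 * x.2 i ^ 2 * (pinnedChain ω₂ lam β γ).gibbsDensity N T x) ∧
    ∫ x, G x.1 * x.2 i ^ 2 * (pinnedChain ω₂ lam β γ).gibbsDensity N T x =
      T * ∫ x, G x.1 * (pinnedChain ω₂ lam β γ).gibbsDensity N T x := by
  have hH0 : ∀ x : PhaseSpace N, 0 ≤ (pinnedChain ω₂ lam β γ).hamiltonian N x := fun x =>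
    pinnedChain_hamiltonian_nonneg hω.le hl hβ γ N x
  have hp2 : ∀ x : PhaseSpace N, x.2 i ^ 2 ≤ 2 * (pinnedChain ω₂ lam β γ).hamiltonian N x :=
    fun x => pinnedChain_sq_momentum_le hω.le hl hβ γ N x i
  have iG : Integrable fun x => G x.1 * (pinnedChain ω₂ lam β γ).gibbsDensity N T x :=
    pinnedChain_integrable_mul_gibbsDensity_of_le hω hl hβ γ N hT (by fun_prop) (C := C)
      fun x => (hle x).trans (by
        nlinarith [mul_nonneg hC (hH0 x), mul_nonneg (mul_nonneg hC (hH0 x)) (hH0 x)])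
  have iGp2 : Integrable fun x => G x.1 * x.2 i ^ 2 * (pinnedChain ω₂ lam β γ).gibbsDensity N T x :=
    pinnedChain_integrable_mul_gibbsDensity_of_le hω hl hβ γ N hT (by fun_prop) (C := 2 * C)
      fun x => by
        rw [abs_mul, abs_of_nonneg (sq_nonneg (x.2 i))]
        calc |G x.1| * x.2 i ^ 2
            ≤ C * (1 + (pinnedChain ω₂ lam β γ).hamiltonian N x) *
                (2 * (pinnedChain ω₂ lam β γ).hamiltonian N x) :=
              mul_le_mul (hle x) (hp2 x) (sq_nonneg _)
                (mul_nonneg hC (add_nonneg zero_le_one (hH0 x)))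
          _ ≤ 2 * C * (1 + (pinnedChain ω₂ lam β γ).hamiltonian N x) ^ 2 := by
              nlinarith [mul_nonneg hC (hH0 x)]
  have iGp : Integrable fun x => G x.1 * x.2 i * (pinnedChain ω₂ lam β γ).gibbsDensity N T x :=
    pinnedChain_integrable_mul_gibbsDensity_of_le hω hl hβ γ N hT (by fun_prop) (C := C)
      fun x => by
        rw [abs_mul]
        have hp1 : |x.2 i| ≤ 1 + (pinnedChain ω₂ lam β γ).hamiltonian N x := by
          have hsq : |x.2 i| ≤ (1 + x.2 i ^ 2) / 2 := by
            nlinarith [sq_nonneg (|x.2 i| - 1), sq_abs (x.2 i), abs_nonneg (x.2 i)]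
          linarith [hp2 x]
        calc |G x.1| * |x.2 i|
            ≤ C * (1 + (pinnedChain ω₂ lam β γ).hamiltonian N x) *
                (1 + (pinnedChain ω₂ lam β γ).hamiltonian N x) :=
              mul_le_mul (hle x) hp1 (abs_nonneg _)
                (mul_nonneg hC (add_nonneg zero_le_one (hH0 x)))
          _ = C * (1 + (pinnedChain ω₂ lam β γ).hamiltonian N x) ^ 2 := by ring
  have e := integral_mul_eq_neg_of_hasLineDerivAt_of_integrable
    (F := fun x : PhaseSpace N => G x.1 * x.2 i) (F' := fun x : PhaseSpace N => G x.1)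
    (g := (pinnedChain ω₂ lam β γ).gibbsDensity N T)
    (g' := fun x => -(x.2 i / T) * (pinnedChain ω₂ lam β γ).gibbsDensity N T x)
    (v := ((0, Pi.single i 1) : PhaseSpace N)) iG ?_ iGp (fun x => ?_)
    (fun x => (pinnedChain ω₂ lam β γ).hasLineDerivAt_gibbsDensity
      ((pinnedChain ω₂ lam β γ).hasLineDerivAt_hamiltonian_unitP N x i))
  · have lhs : ∫ x, G x.1 * x.2 i *
        (-(x.2 i / T) * (pinnedChain ω₂ lam β γ).gibbsDensity N T x) =
        -T⁻¹ * ∫ x, G x.1 * x.2 i ^ 2 * (pinnedChain ω₂ lam β γ).gibbsDensity N T x := by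
      rw [← integral_const_mul]
      refine integral_congr_ae (Filter.Eventually.of_forall fun x => ?_)
      ring
    rw [lhs] at e
    refine ⟨iG, iGp2, ?_⟩
    have hTne : T ≠ 0 := hT.ne'
    calc ∫ x, G x.1 * x.2 i ^ 2 * (pinnedChain ω₂ lam β γ).gibbsDensity N T x
        = T * (T⁻¹ * ∫ x, G x.1 * x.2 i ^ 2 * (pinnedChain ω₂ lam β γ).gibbsDensity N T x) := by
          rw [← mul_assoc, mul_inv_cancel₀ hTne, one_mul]
      _ = T * ∫ x, G x.1 * (pinnedChain ω₂ lam β γ).gibbsDensity N T x := by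
          congr 1
          linarith
  · refine (iGp2.const_mul (-T⁻¹)).congr (Filter.Eventually.of_forall fun x => ?_)
    ring
  · unfold HasLineDerivAt
    have h : (fun t : ℝ => (fun z : PhaseSpace N => G z.1 * z.2 i)
        (x + t • ((0, Pi.single i 1) : PhaseSpace N))) = fun t => G x.1 * (x.2 i + t) := by
      funext t
      simp
    rw [h]
    have h1 : HasDerivAt (fun t : ℝ => x.2 i + t) 1 0 := (hasDerivAt_id' (0 : ℝ)).const_add _
    refine (h1.const_mul (G x.1)).congr_deriv ?_
    ring

/-- **The covariance identity against `e^{-H/T}`.** For the bond `(i, j = i+1)` of the pinned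
chain and any `c`:
`∫ (p_i²/2 + U(q_i) + V(q_j - q_i)/2) (j_i - c (T - p_i²)) e^{-H/T} = c T² ∫ e^{-H/T}`.
[folklore] -/
theorem pinnedChain_integral_siteEnergy_mul_deficit_mul_gibbsDensity (hω : 0 < ω₂) (hl : 0 ≤ lam)
    (hβ : 0 ≤ β) (γ : ℝ) (N : ℕ) {T : ℝ} (hT : 0 < T) {i j : Fin N} (hj : j.val = i.val + 1)
    (c : ℝ) :
    ∫ x, (x.2 i ^ 2 / 2 + (pinnedChain ω₂ lam β γ).U (x.1 i) +
          (pinnedChain ω₂ lam β γ).V (x.1 j - x.1 i) / 2) *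
        ((pinnedChain ω₂ lam β γ).bondCurrent N i x - c * (T - x.2 i ^ 2)) *
        (pinnedChain ω₂ lam β γ).gibbsDensity N T x =
      c * T ^ 2 * ∫ x, (pinnedChain ω₂ lam β γ).gibbsDensity N T x := by
  have hH0 : ∀ x : PhaseSpace N, 0 ≤ (pinnedChain ω₂ lam β γ).hamiltonian N x := fun x =>
    pinnedChain_hamiltonian_nonneg hω.le hl hβ γ N x
  have hU0 : ∀ x : PhaseSpace N, 0 ≤ (pinnedChain ω₂ lam β γ).U (x.1 i) := fun x => by
    show 0 ≤ ω₂ * x.1 i ^ 2 / 2 + lam * x.1 i ^ 4 / 4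
    positivity
  have hUle : ∀ x : PhaseSpace N,
      (pinnedChain ω₂ lam β γ).U (x.1 i) ≤ (pinnedChain ω₂ lam β γ).hamiltonian N x := fun x =>
    pinnedChain_U_le_hamiltonian hω.le hl hβ γ N x i
  have hV0 : ∀ x : PhaseSpace N, 0 ≤ (pinnedChain ω₂ lam β γ).V (x.1 j - x.1 i) := fun x => by
    show 0 ≤ (x.1 j - x.1 i) ^ 2 / 2 + β * (x.1 j - x.1 i) ^ 4 / 4
    positivity
  have hVle : ∀ x : PhaseSpace N,
      (pinnedChain ω₂ lam β γ).V (x.1 j - x.1 i) ≤ (pinnedChain ω₂ lam β γ).hamiltonian N x :=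
    fun x => pinnedChain_bond_le_hamiltonian hω.le hl hβ γ N x hj
  have hp2 : ∀ x : PhaseSpace N, x.2 i ^ 2 ≤ 2 * (pinnedChain ω₂ lam β γ).hamiltonian N x :=
    fun x => pinnedChain_sq_momentum_le hω.le hl hβ γ N x i
  have hUc : Continuous (pinnedChain ω₂ lam β γ).U :=
    (pinnedChain_contDiff_U ω₂ lam β γ (n := 0)).continuous
  have hVc : Continuous (pinnedChain ω₂ lam β γ).V :=
    (pinnedChain_contDiff_V ω₂ lam β γ (n := 0)).continuous
  -- the position part `G(q) = U(q_i) + V(q_j - q_i)/2`: Gaussian integration by parts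
  obtain ⟨iG, iGp2, hIBP⟩ := pinnedChain_integral_posObs_sq_momentum_mul_gibbsDensity hω hl hβ γ N
    hT i (G := fun q : Fin N → ℝ => (pinnedChain ω₂ lam β γ).U (q i) +
      (pinnedChain ω₂ lam β γ).V (q j - q i) / 2)
    ((hUc.comp (continuous_apply i)).add
      ((hVc.comp ((continuous_apply j).sub (continuous_apply i))).div_const 2))
    (C := 3 / 2) (by norm_num) (fun x => by
      rw [abs_of_nonneg (by linarith [hU0 x, hV0 x])]
      linarith [hUle x, hVle x, hH0 x])
  -- momentum moments
  have f2i := pinnedChain_integrable_momentum_pow_mul_gibbsDensity hω hl hβ γ N hT i (k := 2)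
    (by norm_num)
  have f3i := pinnedChain_integrable_momentum_pow_mul_gibbsDensity hω hl hβ γ N hT i (k := 4) le_rfl
  have m2 := pinnedChain_integral_momentum_pow_add_two hω hl hβ γ N hT i (k := 0) (Nat.zero_le _)
  have m4 := pinnedChain_integral_momentum_pow_add_two hω hl hβ γ N hT i (k := 2) le_rfl
  have h0 : ∫ x, x.2 i ^ 0 * (pinnedChain ω₂ lam β γ).gibbsDensity N T x =
      ∫ x, (pinnedChain ω₂ lam β γ).gibbsDensity N T x := by
    simp
  simp only [Nat.reduceAdd, Nat.cast_ofNat, Nat.cast_zero, zero_add, mul_one] at m4 m2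
  rw [h0] at m2
  -- the parity piece `∫ e₀ j_i e^{-H/T} = 0` and its integrability
  have he0c : Continuous fun x : PhaseSpace N => x.2 i ^ 2 / 2 + (pinnedChain ω₂ lam β γ).U (x.1 i) +
      (pinnedChain ω₂ lam β γ).V (x.1 j - x.1 i) / 2 := by
    have h1 : Continuous fun y : PhaseSpace N => y.2 i := by fun_prop
    have h2 : Continuous fun y : PhaseSpace N => y.1 i := by fun_prop
    have h3 : Continuous fun y : PhaseSpace N => y.1 j := by fun_prop
    exact (((h1.pow 2).div_const 2).add (hUc.comp h2)).add ((hVc.comp (h3.sub h2)).div_const 2)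
  have f1i : Integrable fun x => (x.2 i ^ 2 / 2 + (pinnedChain ω₂ lam β γ).U (x.1 i) +
      (pinnedChain ω₂ lam β γ).V (x.1 j - x.1 i) / 2) * (pinnedChain ω₂ lam β γ).bondCurrent N i x *
      (pinnedChain ω₂ lam β γ).gibbsDensity N T x :=
    pinnedChain_integrable_mul_gibbsDensity_of_le_pow_four hω hl hβ γ N hT
      (he0c.mul (pinnedChain_continuous_bondCurrent ω₂ lam β γ N i)) (C := 3 * (N * ((3 + β) / 2)))
      fun x => by
        have hjb := pinnedChain_abs_bondCurrent_le hω.le hl hβ γ N i x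
        have he0 : 0 ≤ x.2 i ^ 2 / 2 + (pinnedChain ω₂ lam β γ).U (x.1 i) +
            (pinnedChain ω₂ lam β γ).V (x.1 j - x.1 i) / 2 := by
          have := hU0 x
          have := hV0 x
          positivity
        have he3 : x.2 i ^ 2 / 2 + (pinnedChain ω₂ lam β γ).U (x.1 i) +
            (pinnedChain ω₂ lam β γ).V (x.1 j - x.1 i) / 2 ≤
            3 * (1 + (pinnedChain ω₂ lam β γ).hamiltonian N x) ^ 2 := by
          nlinarith [hp2 x, hUle x, hVle x, hH0 x, hV0 x, sq_nonneg ((pinnedChain ω₂ lam β γ).hamiltonian N x)]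
        rw [abs_mul, abs_of_nonneg he0]
        calc (x.2 i ^ 2 / 2 + (pinnedChain ω₂ lam β γ).U (x.1 i) +
              (pinnedChain ω₂ lam β γ).V (x.1 j - x.1 i) / 2) *
              |(pinnedChain ω₂ lam β γ).bondCurrent N i x|
            ≤ 3 * (1 + (pinnedChain ω₂ lam β γ).hamiltonian N x) ^ 2 *
                (N * ((3 + β) / 2 * (1 + (pinnedChain ω₂ lam β γ).hamiltonian N x) ^ 2)) :=
              mul_le_mul he3 hjb (abs_nonneg _) (by positivity)
          _ = 3 * (N * ((3 + β) / 2)) * (1 + (pinnedChain ω₂ lam β γ).hamiltonian N x) ^ 4 := by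
              ring
  have f1z := pinnedChain_integral_even_mul_bondCurrent_mul_gibbsDensity ω₂ lam β γ N T i
    (E := fun x : PhaseSpace N => x.2 i ^ 2 / 2 + (pinnedChain ω₂ lam β γ).U (x.1 i) +
      (pinnedChain ω₂ lam β γ).V (x.1 j - x.1 i) / 2) (fun x => by simp)
  exact integral_siteEnergy_combination f1i f1z f2i m2 f3i m4 iG iGp2 hIBP (fun x => by ring)
    (fun x => by ring)

end Pinned

/-- **Stub `stub_siteEnergyCurrentCovariance`** (fact (H4), statics of the line
`bath-bond-deficit-integral`): under the Gibbs state `μ_T = Z⁻¹ e^{-H/T} dq dp` of the pinned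
anharmonic chain `pinnedChain ω₂ lam β γ` with `N ≥ 2` sites, the bath-site energy
`e₀ = p₀²/2 + U(q₀) + V(q₁ - q₀)/2` and the bond current `j₀ = -½(p₀ + p₁) V'(q₁ - q₀)` satisfy
`∫ e₀ (j₀ - γ (T - p₀²)) dμ_T ≤ γ T²` (in fact `=`: `∫ e₀ j₀ dμ_T = 0` by momentum parity,
`∫ (U(q₀) + V/2)(T - p₀²) dμ_T = 0` by Gaussian integration by parts in `p₀`, and
`∫ (p₀²/2)(T - p₀²) dμ_T = (T² - 3T²)/2 = -T²`). [folklore] -/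
theorem stub_siteEnergyCurrentCovariance :
    ∀ ω₂ lam β γ : ℝ, 0 < ω₂ → 0 < lam → 0 < β → 0 < γ → ∀ T : ℝ, 0 < T → ∀ (N : ℕ) (hN : 1 < N),
      ∫ y, ((y.2 ⟨0, Nat.zero_lt_of_lt hN⟩) ^ 2 / 2 + (pinnedChain ω₂ lam β γ).U (y.1 ⟨0, Nat.zero_lt_of_lt hN⟩) +
            (pinnedChain ω₂ lam β γ).V (y.1 ⟨1, hN⟩ - y.1 ⟨0, Nat.zero_lt_of_lt hN⟩) / 2) *
          ((pinnedChain ω₂ lam β γ).bondCurrent N ⟨0, Nat.zero_lt_of_lt hN⟩ y -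
            γ * (T - (y.2 ⟨0, Nat.zero_lt_of_lt hN⟩) ^ 2)) ∂((pinnedChain ω₂ lam β γ).gibbsMeasure N T) ≤
        γ * T ^ 2 := by
  intro ω₂ lam β γ hω hl hβ _hγ T hT N hN
  rw [(pinnedChain ω₂ lam β γ).integral_gibbsMeasure,
    pinnedChain_integral_siteEnergy_mul_deficit_mul_gibbsDensity hω hl.le hβ.le γ N hT
      (i := ⟨0, Nat.zero_lt_of_lt hN⟩) (j := ⟨1, hN⟩) rfl γ]
  have hZ : 0 < ∫ x, (pinnedChain ω₂ lam β γ).gibbsDensity N T x :=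
    integral_exp_pos (pinnedChain_integrable_gibbsDensity hω hl.le hβ.le γ N hT)
  apply le_of_eq
  field_simp

end Summit.AtomisticToContinuum.FouriersLaw.Theorems.SubdiffusiveBondHeat
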